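import Literature.Probability.LatticeModels.LatticeLipschitzPath
import Mathlib.Topology.Sequences
import Mathlib.Topology.MetricSpace.ProperSpace
import Mathlib.Topology.Bases
import HarnessLib

/-!
# Arzelà–Ascoli for lattice functions: locally uniformly convergent subsequences

Topic `Literature/Probability/LatticeModels` (discrete-to-continuum toolkit; second input, after
`LatticeLipschitzPath.lean`, of the convergence of lattice-harmonic functions to harmonic
functions on the discharge path of `Kenyon2000_flatEdgePoissonKernelLimit`). A family
`g n : ℤ² → E` of lattice functions read at meshes `δ n → 0⁺` (site `v` sits at
`meshPoint (δ n) v = δₙ v ∈ ℂ`) which is, near every point of an open set `O ⊆ ℂ`, eventually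
BOUNDED and eventually LATTICE-LIPSCHITZ (`‖g n (v + e_k) - g n v‖ ≤ L δₙ`) has a subsequence
converging locally uniformly on `O` to a continuous function:

* **`exists_subseq_latticeLimit`** — there are `φ` strictly increasing and `G : ℂ → E`
  continuous on `O` such that for every `z ∈ O` there is `r > 0` with
  `sup {‖g (φ n) v - G (δ_{φ n} v)‖ : δ_{φ n} v ∈ B̄(z, r)} → 0`.

Proof (the classical diagonal argument, Arzelà–Ascoli style): along a dense sequence `q k` of
`ℂ` the truncated values `g n (nearestSite (q k))` live in a compact product of closed balls
(`E` proper), whence a subsequence converging at every `q k ∈ O`; the lattice Lipschitz bound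
(`norm_sub_le_of_latticeLipschitz`) makes `n ↦ g (φ n) (nearestSite z)` Cauchy for EVERY `z ∈ O`
(compare with a nearby `q k`), the limit `G` inherits the Lipschitz bound locally, and a finite
net of a small closed ball upgrades pointwise to uniform convergence. Everything is proved,
[folklore]; no named fact.

## References

* W. Rudin, *Real and Complex Analysis*, Thm. 11.28 (Arzelà–Ascoli) — the argument adapted to
  functions on varying lattices as in discrete complex analysis (e.g. Chelkak–Smirnov 2011, §3).
-/

noncomputable section

namespace Literature.Probability.LatticeModels

open Metric Filter Set
open scoped Topology

variable {E : Type*} [NormedAddCommGroup E] [ProperSpace E]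

/-- Mesh points of nearest sites: `dist (δ·nearestSite δ z) w ≤ δ + dist z w`. [folklore] -/
theorem dist_meshPoint_nearestSite_le_add {δ : ℝ} (hδ : 0 < δ) (z w : ℂ) :
    dist (meshPoint δ (nearestSite δ z)) w ≤ δ + dist z w :=
  (dist_triangle _ z w).trans (add_le_add (dist_meshPoint_nearestSite_le hδ z) le_rfl)

/-- **Arzelà–Ascoli for lattice functions.** Let `δ n → 0⁺`, `g n : ℤ² → E` (`E` a proper normed
group), `O ⊆ ℂ` open, and suppose that every `z ∈ O` has a closed ball on which, for all large
`n`, `g n` is bounded (`‖g n v‖ ≤ M` for `δₙ v` in the ball) and lattice-Lipschitz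
(`‖g n (v + e_k) - g n v‖ ≤ L δₙ`). Then a subsequence `g (φ n)` converges locally uniformly on
`O` — uniformly over the sites whose mesh points lie in a small closed ball about each point of
`O` — to a function `G` continuous on `O`. [folklore] -/
theorem exists_subseq_latticeLimit {δ : ℕ → ℝ} (hδ : ∀ n, 0 < δ n)
    (hδ0 : Tendsto δ atTop (𝓝 0)) {g : ℕ → Site 2 → E} {O : Set ℂ} (hO : IsOpen O)
    (hbdd : ∀ z ∈ O, ∃ r > 0, ∃ M : ℝ, ∀ᶠ n in atTop, ∀ v : Site 2,
      meshPoint (δ n) v ∈ closedBall z r → ‖g n v‖ ≤ M)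
    (hlip : ∀ z ∈ O, ∃ r > 0, ∃ L : ℝ, ∀ᶠ n in atTop, ∀ v : Site 2,
      meshPoint (δ n) v ∈ closedBall z r → ∀ k : Fin 4, ‖g n (v + cornerUnit k) - g n v‖ ≤ L * δ n) :
    ∃ φ : ℕ → ℕ, StrictMono φ ∧ ∃ G : ℂ → E, ContinuousOn G O ∧
      ∀ z ∈ O, ∃ r > 0, ∀ ε > 0, ∀ᶠ n in atTop, ∀ v : Site 2,
        meshPoint (δ (φ n)) v ∈ closedBall z r → ‖g (φ n) v - G (meshPoint (δ (φ n)) v)‖ < ε := by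
  -- Lipschitz data at every point of `O`, inside `O`, with a positive constant
  have hlip' : ∀ z ∈ O, ∃ r > 0, ∃ Λ > 0, closedBall z r ⊆ O ∧ ∀ᶠ n in atTop, ∀ v w : Site 2,
      meshPoint (δ n) v ∈ closedBall z (r / 2) → meshPoint (δ n) w ∈ closedBall z (r / 2) →
        ‖g n v - g n w‖ ≤ 2 * Λ * dist (meshPoint (δ n) v) (meshPoint (δ n) w) := by
    intro z hz
    obtain ⟨r₁, hr₁, L, hL⟩ := hlip z hz
    obtain ⟨r₂, hr₂, hsub⟩ := (Metric.nhds_basis_closedBall.mem_iff).1 (hO.mem_nhds hz)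
    refine ⟨min r₁ r₂, lt_min hr₁ hr₂, |L| + 1, by positivity,
      (closedBall_subset_closedBall (min_le_right _ _)).trans hsub, ?_⟩
    filter_upwards [hL] with n hn v w hv hw
    have hv' : meshPoint (δ n) v ∈ closedBall z (r₁ / 2) :=
      closedBall_subset_closedBall (by linarith [min_le_left r₁ r₂]) hv
    have hw' : meshPoint (δ n) w ∈ closedBall z (r₁ / 2) :=
      closedBall_subset_closedBall (by linarith [min_le_left r₁ r₂]) hw
    calc ‖g n v - g n w‖ ≤ 2 * L * dist (meshPoint (δ n) v) (meshPoint (δ n) w) :=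
          norm_sub_le_of_latticeLipschitz (hδ n) hn hv' hw'
      _ ≤ 2 * (|L| + 1) * dist (meshPoint (δ n) v) (meshPoint (δ n) w) := by
          gcongr; linarith [le_abs_self L]
  -- a dense sequence and the bounds at its points
  obtain ⟨q, hq⟩ := TopologicalSpace.exists_dense_seq ℂ
  have hbdd' : ∀ k : ℕ, ∃ r > 0, ∃ M : ℝ, q k ∈ O → ∀ᶠ n in atTop, ∀ v : Site 2,
      meshPoint (δ n) v ∈ closedBall (q k) r → ‖g n v‖ ≤ M := by
    intro k
    by_cases hk : q k ∈ O
    · obtain ⟨r, hr, M, hM⟩ := hbdd (q k) hk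
      exact ⟨r, hr, M, fun _ => hM⟩
    · exact ⟨1, one_pos, 0, fun h => (hk h).elim⟩
  choose rb hrb M hM using hbdd'
  -- the truncated values at the dense points live in a compact product
  set R : ℕ → ℝ := fun k => |M k| with hR
  set y : ℕ → ℕ → E := fun n k =>
    if ‖g n (nearestSite (δ n) (q k))‖ ≤ R k then g n (nearestSite (δ n) (q k)) else 0 with hy
  set K : Set (ℕ → E) := Set.pi Set.univ fun k => closedBall (0 : E) (R k) with hK
  have hKc : IsCompact K := isCompact_univ_pi fun k => isCompact_closedBall (0 : E) (R k)
  have hyK : ∀ n, y n ∈ K := by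
    intro n
    simp only [hK, Set.mem_pi, Set.mem_univ, forall_const, mem_closedBall, dist_zero_right]
    intro k
    simp only [hy]
    split_ifs with h
    · exact h
    · rw [norm_zero]; exact abs_nonneg _
  obtain ⟨yinf, -, φ, hφ, hylim⟩ := hKc.tendsto_subseq hyK
  have hφt : Tendsto φ atTop atTop := hφ.tendsto_atTop
  have hδφ : Tendsto (fun n => δ (φ n)) atTop (𝓝 0) := hδ0.comp hφt
  have hδφpos : ∀ n, 0 < δ (φ n) := fun n => hδ _
  -- convergence at the dense points of `O`
  have hconv_q : ∀ k : ℕ, q k ∈ O →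
      Tendsto (fun n => g (φ n) (nearestSite (δ (φ n)) (q k))) atTop (𝓝 (yinf k)) := by
    intro k hk
    have h1 : Tendsto (fun n => y (φ n) k) atTop (𝓝 (yinf k)) := tendsto_pi_nhds.1 hylim k
    refine h1.congr' ?_
    have h2 : ∀ᶠ n in atTop, δ (φ n) ≤ rb k := (hδφ.eventually (eventually_le_nhds (hrb k)))
    filter_upwards [hφt.eventually (hM k hk), h2] with n hn hn2
    have hmem : meshPoint (δ (φ n)) (nearestSite (δ (φ n)) (q k)) ∈ closedBall (q k) (rb k) :=
      mem_closedBall.2 ((dist_meshPoint_nearestSite_le (hδφpos n) _).trans hn2)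
    have hle : ‖g (φ n) (nearestSite (δ (φ n)) (q k))‖ ≤ R k :=
      (hn _ hmem).trans (le_abs_self _)
    simp only [hy, if_pos hle]
  -- the values at nearest sites
  set a : ℂ → ℕ → E := fun z n => g (φ n) (nearestSite (δ (φ n)) z) with ha
  -- Cauchy at every point of `O`
  have hcauchy : ∀ z ∈ O, CauchySeq (a z) := by
    intro z hz
    obtain ⟨r, hr, Λ, hΛ, hrO, hL⟩ := hlip' z hz
    rw [Metric.cauchySeq_iff]
    intro ε hε
    -- a dense point close to `z`
    set ρ : ℝ := min (r / 4) (ε / (32 * Λ)) with hρ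
    have hρ0 : 0 < ρ := lt_min (by linarith) (by positivity)
    obtain ⟨k, hk⟩ := hq.exists_dist_lt z hρ0
    have hkO : q k ∈ O := hrO (mem_closedBall.2 (by
      rw [dist_comm]; linarith [hk.le, min_le_left (r / 4) (ε / (32 * Λ))]))
    have hb := Metric.cauchySeq_iff.1 (hconv_q k hkO).cauchySeq (ε / 4) (by positivity)
    obtain ⟨N₁, hN₁⟩ := hb
    have hev : ∀ᶠ n in atTop, δ (φ n) ≤ ρ ∧ (∀ v w : Site 2,
        meshPoint (δ (φ n)) v ∈ closedBall z (r / 2) → meshPoint (δ (φ n)) w ∈ closedBall z (r / 2) →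
          ‖g (φ n) v - g (φ n) w‖ ≤ 2 * Λ * dist (meshPoint (δ (φ n)) v) (meshPoint (δ (φ n)) w)) :=
      (hδφ.eventually (eventually_le_nhds hρ0)).and (hφt.eventually hL)
    obtain ⟨N₂, hN₂⟩ := eventually_atTop.1 hev
    refine ⟨max N₁ N₂, fun m hm n hn => ?_⟩
    have hm1 : N₁ ≤ m := le_of_max_le_left hm
    have hn1 : N₁ ≤ n := le_of_max_le_left hn
    obtain ⟨hmδ, hmL⟩ := hN₂ m (le_of_max_le_right hm)
    obtain ⟨hnδ, hnL⟩ := hN₂ n (le_of_max_le_right hn)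
    have hρr : ρ ≤ r / 4 := min_le_left _ _
    have hρε : ρ ≤ ε / (32 * Λ) := min_le_right _ _
    -- comparison of `a z` with the values at the dense point
    have hcomp : ∀ p : ℕ, δ (φ p) ≤ ρ → (∀ v w : Site 2,
        meshPoint (δ (φ p)) v ∈ closedBall z (r / 2) → meshPoint (δ (φ p)) w ∈ closedBall z (r / 2) →
          ‖g (φ p) v - g (φ p) w‖ ≤ 2 * Λ * dist (meshPoint (δ (φ p)) v) (meshPoint (δ (φ p)) w)) →
        dist (a z p) (g (φ p) (nearestSite (δ (φ p)) (q k))) ≤ 3 * ε / 16 := by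
      intro p hpδ hpL
      have hd1 : dist (meshPoint (δ (φ p)) (nearestSite (δ (φ p)) z)) z ≤ δ (φ p) :=
        dist_meshPoint_nearestSite_le (hδφpos p) z
      have hd2 : dist (meshPoint (δ (φ p)) (nearestSite (δ (φ p)) (q k))) z ≤ δ (φ p) + ρ :=
        (dist_meshPoint_nearestSite_le_add (hδφpos p) (q k) z).trans (by rw [dist_comm]; linarith [hk.le])
      have hm1 : meshPoint (δ (φ p)) (nearestSite (δ (φ p)) z) ∈ closedBall z (r / 2) :=
        mem_closedBall.2 (by linarith)
      have hm2 : meshPoint (δ (φ p)) (nearestSite (δ (φ p)) (q k)) ∈ closedBall z (r / 2) :=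
        mem_closedBall.2 (by linarith)
      have h := hpL _ _ hm1 hm2
      rw [dist_eq_norm]
      refine h.trans ?_
      have hdd : dist (meshPoint (δ (φ p)) (nearestSite (δ (φ p)) z))
          (meshPoint (δ (φ p)) (nearestSite (δ (φ p)) (q k))) ≤ 3 * ρ := by
        have := dist_triangle (meshPoint (δ (φ p)) (nearestSite (δ (φ p)) z)) z
          (meshPoint (δ (φ p)) (nearestSite (δ (φ p)) (q k)))
        rw [dist_comm z] at this
        linarith
      calc 2 * Λ * dist (meshPoint (δ (φ p)) (nearestSite (δ (φ p)) z))
            (meshPoint (δ (φ p)) (nearestSite (δ (φ p)) (q k)))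
          ≤ 2 * Λ * (3 * (ε / (32 * Λ))) := by gcongr; linarith
        _ = 3 * ε / 16 := by field_simp; ring
    have h1 := hcomp m hmδ hmL
    have h2 := hcomp n hnδ hnL
    have h3 := hN₁ m hm1 n hn1
    calc dist (a z m) (a z n)
        ≤ dist (a z m) (g (φ m) (nearestSite (δ (φ m)) (q k))) +
          dist (g (φ m) (nearestSite (δ (φ m)) (q k))) (g (φ n) (nearestSite (δ (φ n)) (q k))) +
          dist (g (φ n) (nearestSite (δ (φ n)) (q k))) (a z n) := dist_triangle4 _ _ _ _
      _ ≤ 3 * ε / 16 + ε / 4 + 3 * ε / 16 :=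
          add_le_add (add_le_add h1 h3.le) (by rw [dist_comm]; exact h2)
      _ < ε := by linarith
  -- the limit function
  set G : ℂ → E := fun z => limUnder atTop (a z) with hGdef
  have hG : ∀ z ∈ O, Tendsto (a z) atTop (𝓝 (G z)) := fun z hz =>
    tendsto_nhds_limUnder (cauchySeq_tendsto_of_complete (hcauchy z hz))
  -- local Lipschitz bound for `G`
  have hGlip : ∀ z₀ ∈ O, ∃ r > 0, ∃ Λ > 0, closedBall z₀ r ⊆ O ∧
      (∀ᶠ n in atTop, δ (φ n) ≤ r / 4 ∧ ∀ v w : Site 2,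
        meshPoint (δ (φ n)) v ∈ closedBall z₀ (r / 2) → meshPoint (δ (φ n)) w ∈ closedBall z₀ (r / 2) →
          ‖g (φ n) v - g (φ n) w‖ ≤ 2 * Λ * dist (meshPoint (δ (φ n)) v) (meshPoint (δ (φ n)) w)) ∧
      ∀ z ∈ closedBall z₀ (r / 4), ∀ z' ∈ closedBall z₀ (r / 4), ‖G z - G z'‖ ≤ 2 * Λ * dist z z' := by
    intro z₀ hz₀
    obtain ⟨r, hr, Λ, hΛ, hrO, hL⟩ := hlip' z₀ hz₀
    have hev : ∀ᶠ n in atTop, δ (φ n) ≤ r / 4 ∧ ∀ v w : Site 2,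
        meshPoint (δ (φ n)) v ∈ closedBall z₀ (r / 2) → meshPoint (δ (φ n)) w ∈ closedBall z₀ (r / 2) →
          ‖g (φ n) v - g (φ n) w‖ ≤ 2 * Λ * dist (meshPoint (δ (φ n)) v) (meshPoint (δ (φ n)) w) :=
      (hδφ.eventually (eventually_le_nhds (by linarith))).and (hφt.eventually hL)
    refine ⟨r, hr, Λ, hΛ, hrO, hev, fun z hz z' hz' => ?_⟩
    have hzO : z ∈ O := hrO (closedBall_subset_closedBall (by linarith) hz)
    have hz'O : z' ∈ O := hrO (closedBall_subset_closedBall (by linarith) hz')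
    -- pass to the limit in `‖a z n - a z' n‖ ≤ 2Λ (dist z z' + 2 δ)`
    have hlim1 : Tendsto (fun n => ‖a z n - a z' n‖) atTop (𝓝 ‖G z - G z'‖) :=
      ((hG z hzO).sub (hG z' hz'O)).norm
    have hlim2 : Tendsto (fun n => 2 * Λ * (dist z z' + 2 * δ (φ n))) atTop
        (𝓝 (2 * Λ * (dist z z' + 2 * 0))) :=
      ((hδφ.const_mul 2).const_add _).const_mul _
    rw [mul_zero, add_zero] at hlim2
    refine le_of_tendsto_of_tendsto hlim1 hlim2 ?_
    filter_upwards [hev] with n hn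
    obtain ⟨hnδ, hnL⟩ := hn
    have hzd := mem_closedBall.1 hz
    have hz'd := mem_closedBall.1 hz'
    have hm : meshPoint (δ (φ n)) (nearestSite (δ (φ n)) z) ∈ closedBall z₀ (r / 2) :=
      mem_closedBall.2 ((dist_meshPoint_nearestSite_le_add (hδφpos n) z z₀).trans (by linarith))
    have hm' : meshPoint (δ (φ n)) (nearestSite (δ (φ n)) z') ∈ closedBall z₀ (r / 2) :=
      mem_closedBall.2 ((dist_meshPoint_nearestSite_le_add (hδφpos n) z' z₀).trans (by linarith))
    refine (hnL _ _ hm hm').trans ?_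
    have hd : dist (meshPoint (δ (φ n)) (nearestSite (δ (φ n)) z))
        (meshPoint (δ (φ n)) (nearestSite (δ (φ n)) z')) ≤ dist z z' + 2 * δ (φ n) := by
      have h4 := dist_triangle4 (meshPoint (δ (φ n)) (nearestSite (δ (φ n)) z)) z z'
        (meshPoint (δ (φ n)) (nearestSite (δ (φ n)) z'))
      have e1 := dist_meshPoint_nearestSite_le (hδφpos n) z
      have e2 := dist_meshPoint_nearestSite_le (hδφpos n) z'
      rw [dist_comm] at e2
      linarith
    gcongr
  refine ⟨φ, hφ, G, ?_, ?_⟩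
  · -- continuity on `O`
    intro z₀ hz₀
    obtain ⟨r, hr, Λ, hΛ, -, -, hGl⟩ := hGlip z₀ hz₀
    refine (Metric.continuousAt_iff.2 fun ε hε => ?_).continuousWithinAt
    refine ⟨min (r / 4) (ε / (2 * Λ + 1)), by positivity, fun z hz => ?_⟩
    have hz1 : dist z z₀ < r / 4 := lt_of_lt_of_le hz (min_le_left _ _)
    have hz2 : dist z z₀ < ε / (2 * Λ + 1) := lt_of_lt_of_le hz (min_le_right _ _)
    have hΛ1 : 0 < 2 * Λ + 1 := by positivity
    rw [dist_eq_norm]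
    calc ‖G z - G z₀‖ ≤ 2 * Λ * dist z z₀ :=
          hGl z (mem_closedBall.2 hz1.le) z₀ (mem_closedBall_self (by positivity))
      _ ≤ (2 * Λ + 1) * dist z z₀ := by gcongr; linarith
      _ < (2 * Λ + 1) * (ε / (2 * Λ + 1)) := by gcongr
      _ = ε := by field_simp
  · -- uniform convergence on small closed balls
    intro z₀ hz₀
    obtain ⟨r, hr, Λ, hΛ, hrO, hev, hGl⟩ := hGlip z₀ hz₀
    refine ⟨r / 4, by positivity, fun ε hε => ?_⟩
    set η : ℝ := min (r / 4) (ε / (16 * Λ)) with hη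
    have hη0 : 0 < η := by positivity
    have hηr : η ≤ r / 4 := min_le_left _ _
    have hηε : η ≤ ε / (16 * Λ) := min_le_right _ _
    obtain ⟨t, htsub, htfin, hcover⟩ :=
      finite_cover_balls_of_compact (isCompact_closedBall z₀ (r / 4)) hη0
    have htO : ∀ x ∈ t, x ∈ O := fun x hx =>
      hrO (closedBall_subset_closedBall (by linarith) (htsub hx))
    have hevt : ∀ᶠ n in atTop, ∀ x ∈ t, dist (a x n) (G x) < ε / 4 := by
      refine (htfin.eventually_all).2 fun x hx => ?_
      exact Metric.tendsto_nhds.1 (hG x (htO x hx)) (ε / 4) (by positivity)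
    have hevδ : ∀ᶠ n in atTop, δ (φ n) ≤ η := hδφ.eventually (eventually_le_nhds hη0)
    filter_upwards [hev, hevt, hevδ] with n hn hnt hnδ v hv
    obtain ⟨-, hnL⟩ := hn
    -- a net point `x` close to the mesh point `p` of `v`
    obtain ⟨x, hx, hpx⟩ : ∃ x ∈ t, dist (meshPoint (δ (φ n)) v) x < η := by
      have := hcover hv
      simpa only [Set.mem_iUnion, mem_ball, exists_prop] using this
    have hxB : x ∈ closedBall z₀ (r / 4) := htsub hx
    have hm1 : meshPoint (δ (φ n)) v ∈ closedBall z₀ (r / 2) :=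
      closedBall_subset_closedBall (by linarith) hv
    have hm2 : meshPoint (δ (φ n)) (nearestSite (δ (φ n)) x) ∈ closedBall z₀ (r / 2) :=
      mem_closedBall.2 ((dist_meshPoint_nearestSite_le_add (hδφpos n) x z₀).trans
        (by have := mem_closedBall.1 hxB; linarith))
    -- the three terms
    have h1 : dist (g (φ n) v) (a x n) ≤ 4 * Λ * η := by
      rw [dist_eq_norm]
      refine (hnL _ _ hm1 hm2).trans ?_
      have hd : dist (meshPoint (δ (φ n)) v) (meshPoint (δ (φ n)) (nearestSite (δ (φ n)) x)) ≤ η + η := by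
        have h3 := dist_triangle (meshPoint (δ (φ n)) v) x (meshPoint (δ (φ n)) (nearestSite (δ (φ n)) x))
        have h' := dist_meshPoint_nearestSite_le (hδφpos n) x
        rw [dist_comm] at h'
        linarith
      calc 2 * Λ * dist (meshPoint (δ (φ n)) v) (meshPoint (δ (φ n)) (nearestSite (δ (φ n)) x))
          ≤ 2 * Λ * (η + η) := by gcongr
        _ = 4 * Λ * η := by ring
    have h2 : dist (a x n) (G x) < ε / 4 := hnt x hx
    have h3 : dist (G x) (G (meshPoint (δ (φ n)) v)) ≤ 2 * Λ * η := by
      rw [dist_eq_norm]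
      refine (hGl x hxB _ hv).trans ?_
      gcongr
      rw [dist_comm]
      exact hpx.le
    have hΛη : Λ * η ≤ ε / 16 := by
      calc Λ * η ≤ Λ * (ε / (16 * Λ)) := by gcongr
        _ = ε / 16 := by field_simp
    rw [← dist_eq_norm]
    calc dist (g (φ n) v) (G (meshPoint (δ (φ n)) v))
        ≤ dist (g (φ n) v) (a x n) + dist (a x n) (G x) + dist (G x) (G (meshPoint (δ (φ n)) v)) :=
          dist_triangle4 _ _ _ _
      _ < 4 * Λ * η + ε / 4 + 2 * Λ * η := add_lt_add_of_lt_of_le (add_lt_add_of_le_of_lt h1 h2) h3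
      _ ≤ ε := by nlinarith

end Literature.Probability.LatticeModels
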